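import Summits.ABC.IUTFork.Joshi.TestTensorPacketsStrictMovesExponents
import Summits.ABC.IUTFork.Joshi.TestIsmCriterion
import HarnessLib

/-!
# R-J row Y-14 — the D-09 side conditions `RealisedByStrictMoves ∧ LocalIsosInInd` over the free-Ism line-shell family, I: NECESSITY
# (a §9.4 strict-move route to the q-pilot forces `−3 ∈ M⁺(I)`, the SUBMONOID of `ℤ` generated by the valuations of Ism)

Proof-only TEST file (D-0012; R14 `Joshi/Test*.lean`; 0 `def`, NO `Prop` fact, no `sorry`) of the abc-iut cell, D-0079 sub-cell R-J «JOSHI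
Y-DISCHARGE CENSUS», row **Y-14** of `plan/E/R-J/Y-CENSUS.tsv` (rung LADDER-ABC:A2.RESCUE.J; seat abc-iut-E-t20, lineage T-20 = K. Joshi,
*Construction of Arithmetic Teichmüller Spaces III*, arXiv:2401.13508 **v4** = `Joshi2024ATS3`, §9.4 «Mochizuki's tensor-packet codomain»: typed
`TensorPacketsJoshi*.lean` p429434/p429647/p430055/p430386, bound in `DictionaryTensorPackets.lean` p430617, tested at the two models of record in
`TestTensorPacketsStrictMoves*.lean` p433729/p436982). Part I of two (part II = `TestTensorPacketsStrictMovesRoute.lean`: sufficiency and the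
criterion). TAKES NO SIDE on [IUTchIII] Cor. 3.12, on Joshi's claims or on Mochizuki's report on them; typed ≠ proved ≠ endorsed; a model EXHIBITS
(non-)satisfiability of typed hypotheses, nothing more; the cell locates / conditionally verifies — NO abc claim.

THE ROW. Y-14 = the two D-09 side conditions of p430617 under which abc-iut-E-plan's X-01 glue fires BY THE §9.4 ROUTE: every move of the
dictionary `𝔇` is REALISED as a strict carrier move along an `ℓ*+1`-tuple of arithmeticoids (`RealisedByStrictMoves`; [J-III] Rmk. 9.4.8.2
p.105 l.53–66, Prop. 9.7.5.1 p.112 read summandwise) whose local components are all `𝒟^⊢`-strip automorphisms or all Ism-elements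
(`LocalIsosInInd`, OUR (Ind1)/(Ind2)). Census v0.1: «DECIDED at models (⟺ A1 horn)» — the route fires at abc-iut-E-t41's X-07′ carriers
(Ism = every ℚ-linear automorphism, p433729 §4) and is dead at the pinned carriers (Ism = {±1}, p433729 §5). Parts I–II decide the row over
the WHOLE free-Ism family of abc-iut-E-t58 / abc-iut-E-cx-3 (`IsmPartial.ismShells I` = E-t41's model with the (Ind2) field `Ism := I ∋ 1`
FREE, p438400; setting `ismSetting`, operator `scalRegion`, q-datum `qDatum`; the three pins and the typed Thm. 3.11 hold for every `I`), in
the currency of E-t58's criterion p440522 (S ⟺ `1 − j² ∈ G(I)` for `j ∈ 𝔽_l^⋆`, `G(I)` the additive SUBGROUP of `ℤ` generated by the valuations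
`v_p(g 1)`, `g ∈ I`; `LogvolInvariant ⟺ v_p(I) = 0`). Write `M⁺(I)` for the additive SUBMONOID of `ℤ` generated by the same valuations.

## What is proved here (interface level over c312-7's one-place index `toyIndex`, `ℓ* = 2`, so `1 − j² ∈ {0, −3}`)

* §1 `image_pBall_strictMove`: over ANY line shells `lineShells A I`, a §9.4 strict move along ANY tuple of ANY tensor-packet datum with
  ARBITRARY local components `G(y)_v` carries `B_k` onto `B_{k + Σ_{a ∈ S_{j+1}} v_p(G(z_a)_v 1)}` at label `j` (p433729's cumulativity
  `line_strictMove_scalar` freed from the scalar shape of the components — every line automorphism IS a scalar).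
* §2 NECESSITY `mem_closure_of_strictMovesRoute`: for EVERY reading `I` and EVERY `(𝔇, 𝔗, G, z)` with Y-14 ∧ `BaseIsThetaPilot` ∧
  `DatumEquivariant`, the `ρ`-region of the datum of any point reached from the base by moves is `B_{4+s}` at label `2` with `s ∈ M⁺(I)`
  (`datum_region_two`: under `LocalIsosInInd` every component valuation lies in `M⁺(I)` — signs have valuation `0` —, and E-t41's
  `scalRegion` is equivariant for every packet-automorphism family); so `StdReachable ∧ StandardPointIsQPilot` force `−3 ∈ M⁺(I)`. Hence
  `nonneg_no_route` (NO route when `v_p(I) ⊆ ℤ_{≥0}` — e.g. `I = {id, x ↦ p³·x}`, where S HOLDS by E-t58's criterion, part II) and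
  `isometric_no_route` / `isometric_real_image_pBall`: at an ISOMETRIC reading (`v_p(I) = 0 ⟺ LogvolInvariant`) every move of a Y-14
  dictionary FIXES every ball, so the six hypotheses of `pilotKummerIndRelated_of_strictMoves` are jointly unsatisfiable — p433729 §5
  freed from `I = {±1}` to every isometric `I` (A1's non-isometric horn is NECESSARY for the route).
LOCATED, NOT ADJUDICATED: which Ism print intends ([IUTchII] Ex. 1.8 (iv) / [IUTchIII] Prop. 1.2 (vi) «Ism» ↔ [J-III] §8.11.1 p.91 l.44–46
«ℚ_p-linear isomorphisms σ») is attach point A1 (E-LOCATION §L1) and is NOT decided here. [claim: Joshi2024ATS3, status: disputed]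
[claim: Mochizuki2012, status: disputed] [cite: ScholzeStix2018, §2.2 pp. 9–10]
-/

noncomputable section

open Set

namespace Summit.ABC.IUTFork.Joshi

open Thm311 Cor312 Cor312Vol Cor312.Checks Cor312.IdentifiedNonVacuity Cor312Vol.NaiveWitness Cor312Vol.PinnedWitness
  Literature.IUT.LogThetaLattice IsmScaling IsmPartial

/-! ## 0. Valuations of products; nonnegativity in a generated submonoid -/

section Valuations

variable (p : ℕ) [hp : Fact p.Prime]

/-- `v_p(∏ f_i) = Σ v_p(f_i)` for nonzero rationals. [folklore] -/
theorem padicValRat_finset_prod {ι : Type} (s : Finset ι) (f : ι → ℚ) (hf : ∀ i ∈ s, f i ≠ 0) :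
    padicValRat p (∏ i ∈ s, f i) = ∑ i ∈ s, padicValRat p (f i) := by
  classical
  induction s using Finset.induction_on with
  | empty => simp
  | insert a s ha ih =>
      have hfa : f a ≠ 0 := hf a (Finset.mem_insert_self a s)
      have hfs : ∀ i ∈ s, f i ≠ 0 := fun i hi => hf i (Finset.mem_insert_of_mem hi)
      rw [Finset.prod_insert ha, Finset.sum_insert ha, padicValRat.mul hfa (Finset.prod_ne_zero_iff.2 hfs), ih hfs]

omit hp in
/-- Elements of the submonoid generated by a set of nonnegative integers are nonnegative. [folklore] -/
theorem nonneg_of_mem_closure {s : Set ℤ} (hs : ∀ x ∈ s, 0 ≤ x) {x : ℤ} (hx : x ∈ AddSubmonoid.closure s) : 0 ≤ x := by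
  induction hx using AddSubmonoid.closure_induction with
  | mem y hy => exact hs y hy
  | zero => exact le_rfl
  | add a b _ _ ha hb => exact add_nonneg ha hb

end Valuations

/-! ## 1. A §9.4 strict move with ARBITRARY local components acts on each packet line by the product of the component scalars -/

section LineShells

variable (A I : Set (ℚ ≃ₗ[ℚ] ℚ)) (hA : LinearEquiv.refl ℚ ℚ ∈ A) (hI : LinearEquiv.refl ℚ ℚ ∈ I) (p : ℕ) [hp : Fact p.Prime]

omit hp in
/-- **Cumulativity, general components.** Over the line shells `lineShells A I` (ANY readings `A`, `I`), the §9.4 strict move along the tuple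
`z` with local components `G(y)_v` acts on the label-`j` packet line by `∏_{a ∈ S_{j+1}} G(z_a)_v 1` — one factor per member of Mochizuki's
capsule `S_{j+1}(z) = {z_0,…,z_j}` ([J-III] §9.4.5–9.4.6); every line automorphism is the scalar `G(y)_v 1`. [folklore] -/
theorem line_strictMove (𝔗 : TensorPacketDatum toyIndex) (G : 𝔗.Arith → toyIndex.V → (ℚ ≃ₗ[ℚ] ℚ))
    (z : toyIndex.Label → 𝔗.Arith) (j : toyIndex.Label) (vQ : toyIndex.VQ) (x : signShells.Packet j vQ) :
    line j vQ (𝔗.strictMove (lineShells A I hA hI) G z j vQ x) =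
      (∏ a : toyIndex.Caps j, G (𝔗.capsEntry z j a) () 1) * line j vQ x :=
  line_factorwise_of_smul j vQ _ (fun a => G (𝔗.capsEntry z j a) () 1)
    (fun a y => summandwise_eq_smul_scalar vQ (fun w => G (𝔗.capsEntry z j a) w.1) y) x

omit hp in
/-- The cumulative scalar is nonzero. [folklore] -/
theorem prod_components_ne_zero (𝔗 : TensorPacketDatum toyIndex) (G : 𝔗.Arith → toyIndex.V → (ℚ ≃ₗ[ℚ] ℚ))
    (z : toyIndex.Label → 𝔗.Arith) (j : toyIndex.Label) : (∏ a : toyIndex.Caps j, G (𝔗.capsEntry z j a) () 1) ≠ 0 :=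
  Finset.prod_ne_zero_iff.2 fun _ _ => Repair.CandMochizuki7.rat_linearEquiv_one_ne_zero _

/-- **… so it carries `B_k` onto `B_{k + Σ_{a ∈ S_{j+1}} v_p(G(z_a)_v 1)}`**: the valuation shift of a strict move at label `j` is the SUM of
the valuations of its components over the capsule. [folklore] -/
theorem image_pBall_strictMove (𝔗 : TensorPacketDatum toyIndex) (G : 𝔗.Arith → toyIndex.V → (ℚ ≃ₗ[ℚ] ℚ))
    (z : toyIndex.Label → 𝔗.Arith) (j : toyIndex.Label) (vQ : toyIndex.VQ) (k : ℤ) :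
    𝔗.strictMove (lineShells A I hA hI) G z j vQ '' pBall p j vQ k =
      pBall p j vQ (k + ∑ a : toyIndex.Caps j, padicValRat p (G (𝔗.capsEntry z j a) () 1)) := by
  rw [← padicValRat_finset_prod p Finset.univ _ fun a _ => Repair.CandMochizuki7.rat_linearEquiv_one_ne_zero _]
  exact image_pBall_of_scalar p (prod_components_ne_zero 𝔗 G z j) (line_strictMove A I hA hI 𝔗 G z j vQ) k

end LineShells

/-! ## 2. NECESSITY over the free-Ism family: Y-14 moves shift the regions by elements of `M⁺(I)` -/

section Necessity

variable (p : ℕ) [hp : Fact p.Prime] (I : Set (ℚ ≃ₗ[ℚ] ℚ)) (hI : LinearEquiv.refl ℚ ℚ ∈ I)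
  (𝔇 : Dictionary (ismFull p I hI).toLatticeSituation) (𝔗 : TensorPacketDatum toyIndex)
  (G : 𝔇.Move → 𝔗.Arith → toyIndex.V → (ℚ ≃ₗ[ℚ] ℚ)) (z : 𝔇.Move → toyIndex.Label → 𝔗.Arith)

omit hp in
/-- **Under `LocalIsosInInd` every component valuation lies in `M⁺(I)`** (the (Ind1)-disjunct: signs, valuation `0`; the (Ind2)-disjunct:
an element of `I`). [folklore] -/
theorem val_component_mem_closure (hG : LocalIsosInInd 𝔇 𝔗 G) (g : 𝔇.Move) (y : 𝔗.Arith) (w : toyIndex.V) :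
    padicValRat p (G g y w 1) ∈ AddSubmonoid.closure ((fun g : ℚ ≃ₗ[ℚ] ℚ => padicValRat p (g 1)) '' I) := by
  rcases hG g with h | h
  · obtain ⟨s, hs, hgs⟩ := exists_eq_mul_of_mem_signs (h y w)
    have h0 : padicValRat p (G g y w 1) = 0 := by
      rw [hgs 1, mul_one]
      rcases (abs_eq (zero_le_one' ℚ)).1 hs with h1 | h1
      · rw [h1, padicValRat.one]
      · rw [h1, padicValRat.neg, padicValRat.one]
    rw [h0]
    exact AddSubmonoid.zero_mem _
  · exact AddSubmonoid.subset_closure ⟨G g y w, h y w, rfl⟩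

/-- **Every move of a Y-14 dictionary shifts every ball by an element of `M⁺(I)`**: `real(g)(B_k) = B_{k+s}`, `s ∈ M⁺(I)`, at every label.
[folklore] -/
theorem real_image_pBall (hR : RealisedByStrictMoves 𝔇 𝔗 G z) (hG : LocalIsosInInd 𝔇 𝔗 G)
    (g : 𝔇.Move) (j : toyIndex.Label) (vQ : toyIndex.VQ) (k : ℤ) :
    ∃ s ∈ AddSubmonoid.closure ((fun g : ℚ ≃ₗ[ℚ] ℚ => padicValRat p (g 1)) '' I),
      𝔇.real g j vQ '' pBall p j vQ k = pBall p j vQ (k + s) :=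
  ⟨∑ a : toyIndex.Caps j, padicValRat p (G g (𝔗.capsEntry (z g) j a) () 1),
    AddSubmonoid.sum_mem _ fun a _ => val_component_mem_closure p I hI 𝔇 𝔗 G hG g _ (), by
      rw [hR g]
      exact image_pBall_strictMove signs I (Set.mem_insert _ _) hI p 𝔗 (G g) (z g) j vQ k⟩

/-- **The region of the datum along a path of moves.** With `BaseIsThetaPilot` (base datum `Ψ_v`, region `B_4 = B_{2²}` at label `2`) and
`DatumEquivariant` (the datum moves by `starAut (real g)`; E-t41's operator `scalRegion` is equivariant for EVERY packet-automorphism family),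
the datum of `gs · base` has `ρ`-region `B_{4+s}` at label `2` with `s ∈ M⁺(I)`. [folklore] -/
theorem datum_region_two (hR : RealisedByStrictMoves 𝔇 𝔗 G z) (hG : LocalIsosInInd 𝔇 𝔗 G)
    (hB : BaseIsThetaPilot 𝔇 (P := ismSetting p I hI)) (hE : DatumEquivariant 𝔇) (gs : List 𝔇.Move) :
    ∃ s ∈ AddSubmonoid.closure ((fun g : ℚ ≃ₗ[ℚ] ℚ => padicValRat p (g 1)) '' I),
      scalRegion p (𝔇.datum (gs.foldr 𝔇.act 𝔇.base)) 2 () = pBall p 2 () (4 + s) := by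
  induction gs with
  | nil =>
      refine ⟨0, AddSubmonoid.zero_mem _, ?_⟩
      have h0 : 𝔇.datum 𝔇.base = fun v _ => Psi p v := hB
      have h4 : jsq (2 : toyIndex.Label) = 4 := rfl
      rw [List.foldr_nil, h0, scalRegion_Psi, if_neg (by decide), h4, add_zero]
  | cons g gs ih =>
      obtain ⟨s, hs, hreg⟩ := ih
      obtain ⟨t, ht, himg⟩ := real_image_pBall p I hI 𝔇 𝔗 G z hR hG g 2 () (4 + s)
      refine ⟨s + t, AddSubmonoid.add_mem _ hs ht, ?_⟩
      have hd : 𝔇.datum (𝔇.act g (gs.foldr 𝔇.act 𝔇.base)) =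
          fun v hv => signShells.starAut (𝔇.real g) v '' 𝔇.datum (gs.foldr 𝔇.act 𝔇.base) v hv :=
        funext fun v => funext fun hv => hE g _ v hv
      rw [List.foldr_cons, hd, scalRegion_equivariant p (𝔇.real g) _ 2 (), hreg, ← add_assoc]
      exact himg

/-- **NECESSITY.** If a Y-14 dictionary (`RealisedByStrictMoves ∧ LocalIsosInInd`) over the reading `I` has `BaseIsThetaPilot ∧
DatumEquivariant ∧ StdReachable ∧ StandardPointIsQPilot`, then `−3 = 1 − 2² ∈ M⁺(I)`: the standard point's region at label `2` must be the
q-region `B_1 = B_{4−3}`. [folklore] -/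
theorem mem_closure_of_strictMovesRoute (hR : RealisedByStrictMoves 𝔇 𝔗 G z) (hG : LocalIsosInInd 𝔇 𝔗 G)
    (hB : BaseIsThetaPilot 𝔇 (P := ismSetting p I hI)) (hE : DatumEquivariant 𝔇) (hS : StdReachable 𝔇)
    (hQ : StandardPointIsQPilot (scalRegion p) (qDatum p) 𝔇) :
    (-3 : ℤ) ∈ AddSubmonoid.closure ((fun g : ℚ ≃ₗ[ℚ] ℚ => padicValRat p (g 1)) '' I) := by
  obtain ⟨gs, hgs⟩ := hS
  obtain ⟨s, hs, hreg⟩ := datum_region_two p I hI 𝔇 𝔗 G z hR hG hB hE gs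
  rw [hgs] at hreg
  have h := hQ 2 ()
  rw [hreg, scalRegion_qDatum p (by decide)] at h
  have h' := pBall_injective p 2 () h
  have h3 : s = -3 := by omega
  rw [← h3]
  exact hs

/-- **The NONNEGATIVE-DRIFT obstruction**: if every element of `I` has valuation `≥ 0` — in particular at every ISOMETRIC reading — then
`M⁺(I) ⊆ ℤ_{≥0} ∌ −3`, so NO Y-14 dictionary over `I` satisfies the other X-01 hypotheses together with Y₂. [folklore] -/
theorem nonneg_no_route (hpos : ∀ g ∈ I, 0 ≤ padicValRat p (g 1)) (hR : RealisedByStrictMoves 𝔇 𝔗 G z)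
    (hG : LocalIsosInInd 𝔇 𝔗 G) (hB : BaseIsThetaPilot 𝔇 (P := ismSetting p I hI)) (hE : DatumEquivariant 𝔇) (hS : StdReachable 𝔇) :
    ¬ StandardPointIsQPilot (scalRegion p) (qDatum p) 𝔇 := fun hQ => by
  have h := nonneg_of_mem_closure (s := (fun g : ℚ ≃ₗ[ℚ] ℚ => padicValRat p (g 1)) '' I)
    (by rintro _ ⟨g, hg, rfl⟩; exact hpos g hg) (mem_closure_of_strictMovesRoute p I hI 𝔇 𝔗 G z hR hG hB hE hS hQ)
  omega

/-- **ISOMETRIC readings (`v_p(I) = 0`, i.e. `LogvolInvariant` by E-t58's `logvolInvariant_iff`): every move of a Y-14 dictionary FIXES every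
ball** — it is (Ind)-trivial on regions (abc-iut-E-cx's X-06 shape), whatever `(𝔗, G, z)`. [folklore] -/
theorem isometric_real_image_pBall (hiso : ∀ g ∈ I, padicValRat p (g 1) = 0) (hR : RealisedByStrictMoves 𝔇 𝔗 G z)
    (hG : LocalIsosInInd 𝔇 𝔗 G) (g : 𝔇.Move) (j : toyIndex.Label) (vQ : toyIndex.VQ) (k : ℤ) :
    𝔇.real g j vQ '' pBall p j vQ k = pBall p j vQ k := by
  obtain ⟨s, hs, h⟩ := real_image_pBall p I hI 𝔇 𝔗 G z hR hG g j vQ k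
  have hle : AddSubmonoid.closure ((fun g : ℚ ≃ₗ[ℚ] ℚ => padicValRat p (g 1)) '' I) ≤ ⊥ :=
    AddSubmonoid.closure_le.2 fun x hx => by
      obtain ⟨g', hg', rfl⟩ := hx
      show padicValRat p (g' 1) ∈ (⊥ : AddSubmonoid ℤ)
      rw [AddSubmonoid.mem_bot]
      exact hiso g' hg'
  have hs0 : s = 0 := AddSubmonoid.mem_bot.1 (hle hs)
  rw [h, hs0, add_zero]

/-- **… so at an isometric reading the six hypotheses of `pilotKummerIndRelated_of_strictMoves` (p430617) are jointly UNSATISFIABLE** —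
p433729's `pinned_strictMoves_not_stdIsQPilot` freed from `I = {±1}` to EVERY isometric `I`. [folklore] -/
theorem isometric_no_route (hiso : ∀ g ∈ I, padicValRat p (g 1) = 0) (hR : RealisedByStrictMoves 𝔇 𝔗 G z)
    (hG : LocalIsosInInd 𝔇 𝔗 G) (hB : BaseIsThetaPilot 𝔇 (P := ismSetting p I hI)) (hE : DatumEquivariant 𝔇) (hS : StdReachable 𝔇) :
    ¬ StandardPointIsQPilot (scalRegion p) (qDatum p) 𝔇 :=
  nonneg_no_route p I hI 𝔇 𝔗 G z (fun g hg => (hiso g hg).symm.le) hR hG hB hE hS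

end Necessity

end Summit.ABC.IUTFork.Joshi

end
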